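import Mathlib.Algebra.MvPolynomial.Degrees
import Mathlib.Algebra.MvPolynomial.Eval
import Mathlib.Algebra.Order.Floor.Defs
import Mathlib.Analysis.SpecialFunctions.Pow.Real
import Literature.Computability.MetaComplexity.RazborovSmolenskyPoly
import HarnessLib

/-!
# Probabilistic polynomials and probabilistic degree (Razborov; Srinivasan–Tripathi–Venkitesh)

The notion behind the polynomial method for `AC⁰[p]`-type classes, as a stand-alone definition:
an **`ε`-error probabilistic polynomial** (poly-tuple) for a Boolean function (tuple of Boolean
functions) `f` on `{0,1}ⁿ` is a probability distribution with finite support over polynomials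
(tuples of polynomials) `P ∈ F[X_1,…,X_n]` such that at EVERY input `x`, `Pr_P[P(x) ≠ f(x)] ≤ ε`;
its degree is `≤ d` if the support consists of polynomials of total degree `≤ d`, and the
`ε`-error probabilistic degree `pdeg_ε(f)` is the least such `d` (Srinivasan–Tripathi–Venkitesh
2021, Def. 1 and Def. 16 = Grewal–Kumar 2024, Def. 3.3; implicit in Razborov 1987).

* `ProbPolyTuple F n m` — a finitely supported distribution over `m`-tuples of polynomials in
  `MvPolynomial (Fin n) F` (support + nonnegative real weights of total mass `1`), with
  `DegLE`, `Errs`, `errProb`, `Approximates`;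
* `HasProbDegree F f ε d` — "`pdeg_ε(f) ≤ d`" in the printed (distribution) form;
* `HasUniformProbDegree F f ε d` — the same with a distribution UNIFORM ON A LIST (`N ≥ 1`
  tuples, at most `ε·N` err at each input): the form a circuit construction reads off a seed;
* `hasProbDegree_of_uniform` (trivial direction) and
  `ProbPolyTuple.exists_uniform_family` / `hasUniformProbDegree_of_hasProbDegree` — ROUNDING a
  finitely supported distribution to `N` slots (`⌊w(P)·N⌋` copies of each `P`; error
  `ε ↦ ε + |supp|/N`), so the two forms agree up to any slack `δ > 0` in `ε`;
* `hasUniformProbDegree_exact`, `hasProbDegree_exact` — non-vacuity / the base case of every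
  induction: the exact multilinear representation (`exactPoly`) has error `0` and degree `≤ n`;
* `eval_fn_mem_lowDeg` — COMPOSITION: a polynomial of total degree `≤ d` evaluated at functions
  of degree `≤ Δ` (the tree's filtration `Smolensky.lowDeg`) has degree `≤ d·Δ` — the bridge from
  `MvPolynomial` statements (as printed) to the `CubeFn`/`lowDeg` calculus of
  `RazborovSmolenskyPoly.lean`.

Purpose: the vocabulary in which sharper gate lemmas are printed — e.g. Srinivasan–Tripathi–
Venkitesh 2021 Thm. 18 (`pdeg_ε(Thr_n^t) = O(√(t log(1/ε)) + log(1/ε))`), used by Grewal–Kumar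
2024 Lemma 3.6 for the additive degree `O(k + log(1/ε))` of `G(k)` gates (the tree's
`RazborovSmolenskyBall*.lean` prove the product form without it).

Deliberately NOT here: any specific upper bound beyond the exact one (Razborov's OR bound lives,
in circuit form, in `RazborovSmolenskyPoly/Approx.lean`); error reduction by majority; lower
bounds (Smolensky).

## References

* S. Srinivasan, U. Tripathi, S. Venkitesh, *On the probabilistic degrees of symmetric Boolean
  functions*, SIAM J. Discrete Math. 35 (2021) / FSTTCS 2019, arXiv:1910.02465, Def. 1, Def. 16,
  §3.1.1 [SrinivasanTripathiVenkitesh2021].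
* S. Grewal, V. M. Kumar, *Improved circuit lower bounds and quantum-classical separations*,
  arXiv:2408.16406 (2024), Def. 3.3, Thm. 3.8 [GrewalKumar2024].
-/

noncomputable section

namespace Literature.Computability.MetaComplexity

open Finset Literature.Computability.Complexity

namespace Smolensky

open scoped Classical

/-! ### Composition: polynomials of bounded total degree preserve the degree filtration -/

section Compose

variable {F : Type*} [Field F] {n m : ℕ}

/-- Products with varying degrees: `u i ∈ lowDeg (D i)` for `i ∈ T` ⇒ `Π_{i∈T} u i ∈ lowDeg (Σ_{i∈T} D i)`.
[folklore] -/
private theorem prod_mem_lowDeg_sum {ι : Type*} (T : Finset ι) {u : ι → CubeFn F n} {D : ι → ℕ}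
    (h : ∀ i ∈ T, u i ∈ lowDeg F n (D i)) : ∏ i ∈ T, u i ∈ lowDeg F n (∑ i ∈ T, D i) := by
  induction T using Finset.cons_induction with
  | empty => simpa using one_mem_lowDeg (F := F) (n := n) 0
  | cons a T ha ih =>
    rw [Finset.prod_cons, Finset.sum_cons]
    exact mul_mem_lowDeg_add (h a (Finset.mem_cons_self a T))
      (ih fun i hi => h i (Finset.mem_cons.2 (Or.inr hi)))

/-- **Composition multiplies degrees** (the step "composing the gate polynomials according to the
structure of the circuit" in every polynomial-method argument): evaluating a polynomial
`P ∈ F[X_1, …, X_m]` of total degree `≤ d` at functions `W_1, …, W_m : {0,1}ⁿ → F` of degree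
`≤ Δ` gives a function of degree `≤ d·Δ`. [cite: GrewalKumar2024, Thm. 3.8 (proof)] -/
theorem eval_fn_mem_lowDeg {d Δ : ℕ} (P : MvPolynomial (Fin m) F) (hP : P.totalDegree ≤ d)
    (W : Fin m → CubeFn F n) (hW : ∀ i, W i ∈ lowDeg F n Δ) :
    (fun x => MvPolynomial.eval (fun i => W i x) P) ∈ lowDeg F n (d * Δ) := by
  have e : (fun x => MvPolynomial.eval (fun i => W i x) P) =
      ∑ s ∈ P.support, P.coeff s • ∏ i, W i ^ s i := by
    funext x
    rw [MvPolynomial.eval_eq']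
    simp [Finset.sum_apply, Finset.prod_apply]
  rw [e]
  refine Submodule.sum_mem _ fun s hs => Submodule.smul_mem _ _ ?_
  have hprod : ∏ i, W i ^ s i ∈ lowDeg F n (∑ i, s i * Δ) :=
    prod_mem_lowDeg_sum univ fun i _ => pow_mem_lowDeg (hW i) (s i)
  refine lowDeg_mono ?_ hprod
  rw [← Finset.sum_mul]
  refine Nat.mul_le_mul_right _ (le_trans ?_ hP)
  have h := MvPolynomial.le_totalDegree hs
  rw [Finsupp.sum_fintype _ _ (by simp)] at h
  exact h

end Compose

/-! ### Probabilistic polynomials (Razborov; STV 2021 Def. 1 / 16; Grewal–Kumar 2024 Def. 3.3) -/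

section ProbPoly

variable (F : Type*) [Field F] (n m : ℕ)

/-- The value of a bit in the field: `1` for `true`, `0` for `false`. [folklore] -/
def boolVal (b : Bool) : F := if b then 1 else 0

/-- **A probabilistic poly-tuple** (Srinivasan–Tripathi–Venkitesh 2021, Def. 16; for `m = 1`
Def. 1 = Razborov's probabilistic polynomial = Grewal–Kumar 2024 Def. 3.3): a probability
distribution with FINITE support over `m`-tuples of polynomials in `F[X_1, …, X_n]` — given by its
support and nonnegative real weights summing to `1`. [cite: SrinivasanTripathiVenkitesh2021, Definition 16] -/
structure ProbPolyTuple where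
  /-- The (finite) support of the distribution. -/
  support : Finset (Fin m → MvPolynomial (Fin n) F)
  /-- The weights (probabilities); only the values on `support` matter. -/
  weight : (Fin m → MvPolynomial (Fin n) F) → ℝ
  /-- Weights are nonnegative. -/
  weight_nonneg : ∀ P, 0 ≤ weight P
  /-- Total mass one. -/
  sum_weight : ∑ P ∈ support, weight P = 1

variable {F n m}

namespace ProbPolyTuple

/-- The distribution is supported on tuples of polynomials of (total) degree `≤ d`
(STV: "the degree of **P** is at most `d`"). [cite: SrinivasanTripathiVenkitesh2021, Definition 16] -/
def DegLE (μ : ProbPolyTuple F n m) (d : ℕ) : Prop :=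
  ∀ P ∈ μ.support, ∀ i, (P i).totalDegree ≤ d

/-- A tuple of polynomials errs at the Boolean point `x` for the tuple of Boolean functions `f`:
some coordinate evaluates to something other than `[f_i(x)]`.
[cite: SrinivasanTripathiVenkitesh2021, Definition 16] -/
def Errs (f : Fin m → (Fin n → Bool) → Bool) (P : Fin m → MvPolynomial (Fin n) F)
    (x : Fin n → Bool) : Prop :=
  ∃ i, MvPolynomial.eval (fun j => boolVal F (x j)) (P i) ≠ boolVal F (f i x)

/-- The error probability at `x`: the mass of the tuples that err at `x`.
[cite: SrinivasanTripathiVenkitesh2021, Definition 16] -/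
def errProb (μ : ProbPolyTuple F n m) (f : Fin m → (Fin n → Bool) → Bool) (x : Fin n → Bool) : ℝ :=
  ∑ P ∈ μ.support.filter (fun P => Errs f P x), μ.weight P

/-- `μ` is an `ε`-error probabilistic poly-tuple for `f`: at EVERY input the error probability is
at most `ε`. [cite: SrinivasanTripathiVenkitesh2021, Definition 16] -/
def Approximates (μ : ProbPolyTuple F n m) (f : Fin m → (Fin n → Bool) → Bool) (ε : ℝ) : Prop :=
  ∀ x, μ.errProb f x ≤ ε

/-- Error probabilities are nonnegative. [cite: SrinivasanTripathiVenkitesh2021, Definition 16] -/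
theorem errProb_nonneg (μ : ProbPolyTuple F n m) (f : Fin m → (Fin n → Bool) → Bool)
    (x : Fin n → Bool) : 0 ≤ μ.errProb f x :=
  Finset.sum_nonneg fun P _ => μ.weight_nonneg P

/-- Error probabilities are at most `1`. [cite: SrinivasanTripathiVenkitesh2021, Definition 16] -/
theorem errProb_le_one (μ : ProbPolyTuple F n m) (f : Fin m → (Fin n → Bool) → Bool)
    (x : Fin n → Bool) : μ.errProb f x ≤ 1 := by
  rw [← μ.sum_weight]
  exact Finset.sum_le_sum_of_subset_of_nonneg (Finset.filter_subset _ _)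
    fun P _ _ => μ.weight_nonneg P

end ProbPolyTuple

/-- **`ε`-error probabilistic degree at most `d`** (STV 2021 Def. 16: `pdeg_ε(f) ≤ d`): the tuple
`f = (f_1, …, f_m)` of Boolean functions on `{0,1}ⁿ` has an `ε`-error probabilistic poly-tuple
over `F` supported on tuples of polynomials of degree `≤ d`.
[cite: SrinivasanTripathiVenkitesh2021, Definition 16] -/
def HasProbDegree (F : Type*) [Field F] {n m : ℕ} (f : Fin m → (Fin n → Bool) → Bool) (ε : ℝ)
    (d : ℕ) : Prop :=
  ∃ μ : ProbPolyTuple F n m, μ.DegLE d ∧ μ.Approximates f ε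

/-- **Uniform-family form**: `N ≥ 1` tuples of degree-`≤ d` polynomials (repetitions allowed)
such that at every input at most `ε·N` of them err — i.e. a probabilistic poly-tuple whose
distribution is uniform on a list; the form used when the randomness is a seed read by a circuit
construction. [cite: GrewalKumar2024, Definition 3.3] -/
def HasUniformProbDegree (F : Type*) [Field F] {n m : ℕ} (f : Fin m → (Fin n → Bool) → Bool)
    (ε : ℝ) (d : ℕ) : Prop :=
  ∃ N : ℕ, 0 < N ∧ ∃ G : Fin N → (Fin m → MvPolynomial (Fin n) F),
    (∀ j i, (G j i).totalDegree ≤ d) ∧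
      ∀ x, ((univ.filter fun j => ProbPolyTuple.Errs f (G j) x).card : ℝ) ≤ ε * N

/-! ### Between the two forms -/

/-- A uniform family is a probabilistic poly-tuple (weights `= multiplicity / N`).
[cite: SrinivasanTripathiVenkitesh2021, Definition 16] -/
theorem hasProbDegree_of_uniform {f : Fin m → (Fin n → Bool) → Bool} {ε : ℝ} {d : ℕ}
    (h : HasUniformProbDegree F f ε d) : HasProbDegree F f ε d := by
  obtain ⟨N, hN, G, hdeg, herr⟩ := h
  have hNr : (0 : ℝ) < N := by exact_mod_cast hN
  let w : (Fin m → MvPolynomial (Fin n) F) → ℝ :=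
    fun P => ((univ.filter fun j => G j = P).card : ℝ) / N
  have hw0 : ∀ P, 0 ≤ w P := fun P => by positivity
  -- mass of a set of tuples = number of indices landing in it, over `N`
  have hmass : ∀ S : Finset (Fin m → MvPolynomial (Fin n) F),
      ∑ P ∈ S, w P = ((univ.filter fun j => G j ∈ S).card : ℝ) / N := by
    intro S
    simp only [w, ← Finset.sum_div]
    congr 1
    rw [← Nat.cast_sum, Finset.card_eq_sum_card_fiberwise (f := G) (s := univ.filter fun j => G j ∈ S)
      (t := S) (fun j hj => (Finset.mem_filter.1 hj).2)]
    refine congrArg _ (Finset.sum_congr rfl fun P hP => ?_)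
    congr 1
    ext j
    simp only [Finset.mem_filter, Finset.mem_univ, true_and]
    exact ⟨fun h => ⟨by rw [h]; exact hP, h⟩, fun h => h.2⟩
  refine ⟨⟨univ.image G, w, hw0, ?_⟩, ?_, ?_⟩
  · rw [hmass]
    have : (univ.filter fun j => G j ∈ univ.image G) = univ := by
      ext j; simp
    rw [this, Finset.card_univ, Fintype.card_fin, div_self hNr.ne']
  · intro P hP i
    obtain ⟨j, _, rfl⟩ := Finset.mem_image.1 hP
    exact hdeg j i
  · intro x
    unfold ProbPolyTuple.errProb
    rw [hmass, div_le_iff₀ hNr]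
    refine le_trans ?_ (herr x)
    exact_mod_cast Finset.card_le_card fun j hj => by
      simp only [Finset.mem_filter, Finset.mem_univ, true_and, Finset.mem_image] at hj ⊢
      exact hj.2

/-! ### Non-vacuity: exact representation, `0`-error probabilistic degree `≤ n` -/

/-- The multilinear polynomial `Σ_a [f a] Π_i (X_i if a_i else 1 - X_i)` representing `f`
exactly on the cube. [folklore] -/
def exactPoly (F : Type*) [Field F] {n : ℕ} (f : (Fin n → Bool) → Bool) : MvPolynomial (Fin n) F :=
  ∑ a : Fin n → Bool, MvPolynomial.C (boolVal F (f a)) *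
    ∏ i, (if a i then MvPolynomial.X i else 1 - MvPolynomial.X i)

/-- The exact representation has total degree `≤ n`. [folklore] -/
private theorem totalDegree_exactPoly_le (f : (Fin n → Bool) → Bool) :
    (exactPoly F f).totalDegree ≤ n := by
  unfold exactPoly
  refine MvPolynomial.totalDegree_finsetSum_le fun a _ => ?_
  refine (MvPolynomial.totalDegree_mul _ _).trans ?_
  rw [MvPolynomial.totalDegree_C, zero_add]
  refine (MvPolynomial.totalDegree_finsetProd _ _).trans ?_
  calc ∑ i, (if a i then MvPolynomial.X i else 1 - MvPolynomial.X i : MvPolynomial (Fin n) F).totalDegree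
      ≤ ∑ _i : Fin n, 1 := Finset.sum_le_sum fun i _ => by
        split_ifs
        · rw [MvPolynomial.totalDegree_X]
        · refine (MvPolynomial.totalDegree_sub _ _).trans ?_
          rw [MvPolynomial.totalDegree_one, MvPolynomial.totalDegree_X]
          simp
    _ = n := by simp

/-- The exact representation evaluates to `[f x]` at every Boolean point. [folklore] -/
private theorem eval_exactPoly (f : (Fin n → Bool) → Bool) (x : Fin n → Bool) :
    MvPolynomial.eval (fun j => boolVal F (x j)) (exactPoly F f) = boolVal F (f x) := by
  unfold exactPoly
  rw [map_sum]
  have hfac : ∀ a : Fin n → Bool, MvPolynomial.eval (fun j => boolVal F (x j))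
      (∏ i, (if a i then MvPolynomial.X i else 1 - MvPolynomial.X i : MvPolynomial (Fin n) F)) =
      if a = x then 1 else 0 := by
    intro a
    rw [map_prod]
    have h1 : ∀ i, MvPolynomial.eval (fun j => boolVal F (x j))
        (if a i then MvPolynomial.X i else 1 - MvPolynomial.X i : MvPolynomial (Fin n) F) =
        if a i = x i then 1 else 0 := by
      intro i
      cases ha : a i <;> cases hx : x i <;> simp [boolVal, hx]
    simp_rw [h1]
    rw [Finset.prod_boole]
    by_cases hax : a = x
    · subst hax; simp
    · rw [if_neg, if_neg hax]
      intro hall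
      exact hax (funext fun i => hall i (Finset.mem_univ i))
  simp_rw [map_mul, MvPolynomial.eval_C, hfac, mul_ite, mul_one, mul_zero]
  rw [Finset.sum_ite_eq']
  simp

/-- **Non-vacuity / base case**: every tuple of Boolean functions on `{0,1}ⁿ` has a `0`-error
probabilistic poly-tuple of degree `≤ n` (one exact tuple), in the uniform-family form.
[cite: SrinivasanTripathiVenkitesh2021, §3.1.1 (Base Case)] -/
theorem hasUniformProbDegree_exact (f : Fin m → (Fin n → Bool) → Bool) :
    HasUniformProbDegree F f 0 n := by
  refine ⟨1, Nat.one_pos, fun _ i => exactPoly F (f i), fun _ i => totalDegree_exactPoly_le (f i),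
    fun x => ?_⟩
  rw [zero_mul]
  have h0 : (univ.filter fun j : Fin 1 => ProbPolyTuple.Errs f (fun i => exactPoly F (f i)) x) = ∅ := by
    refine Finset.filter_eq_empty_iff.2 fun j _ => ?_
    rintro ⟨i, hi⟩
    exact hi (eval_exactPoly (f i) x)
  rw [h0, Finset.card_empty, Nat.cast_zero]

/-- Every tuple has `0`-error probabilistic degree `≤ n`. [cite: SrinivasanTripathiVenkitesh2021, §3.1.1 (Base Case)] -/
theorem hasProbDegree_exact (f : Fin m → (Fin n → Bool) → Bool) : HasProbDegree F f 0 n :=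
  hasProbDegree_of_uniform (hasUniformProbDegree_exact f)

/-! ### Rounding a finitely supported distribution to a uniform family -/

/-- Summing a function over the entries of a list, by position. [folklore] -/
private theorem sum_range_getD {α M : Type*} [AddCommMonoid M] (g : α → M) (a : α) :
    ∀ L : List α, ∑ i ∈ range L.length, g (L.getD i a) = (L.map g).sum
  | [] => by simp
  | y :: L => by
    rw [List.length_cons, Finset.sum_range_succ', List.getD_cons_zero, List.map_cons, List.sum_cons,
      add_comm]
    congr 1
    simp only [List.getD_cons_succ]
    exact sum_range_getD g a L

/-- **Rounding to a uniform family** (the step from a finitely supported distribution to a seed a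
construction can read): for every `N ≥ 1`, an `ε`-error probabilistic poly-tuple `μ` yields `N`
tuples FROM ITS SUPPORT (so of the same degrees) erring at every input on at most
`ε·N + |supp μ|` of the `N` indices (`⌊w(P)·N⌋` copies of each `P`, the `< |supp μ|` leftover
indices filled with a fixed tuple). [cite: GrewalKumar2024, Thm. 3.8 (proof, averaging)] -/
theorem ProbPolyTuple.exists_uniform_family (μ : ProbPolyTuple F n m)
    (f : Fin m → (Fin n → Bool) → Bool) {ε : ℝ} (happ : μ.Approximates f ε) (N : ℕ) :
    ∃ G : Fin N → (Fin m → MvPolynomial (Fin n) F), (∀ j, G j ∈ μ.support) ∧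
      ∀ x, ((univ.filter fun j => Errs f (G j) x).card : ℝ) ≤ ε * N + μ.support.card := by
  -- the support is nonempty
  have hne : μ.support.Nonempty := by
    by_contra h
    rw [Finset.not_nonempty_iff_eq_empty] at h
    have := μ.sum_weight
    rw [h, Finset.sum_empty] at this
    exact zero_ne_one this
  obtain ⟨P₀, hP₀⟩ := hne
  -- slot counts
  set c : (Fin m → MvPolynomial (Fin n) F) → ℕ := fun P => ⌊μ.weight P * N⌋₊ with hc
  have hcle : ∀ P, (c P : ℝ) ≤ μ.weight P * N := fun P =>
    Nat.floor_le (mul_nonneg (μ.weight_nonneg P) (Nat.cast_nonneg N))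
  have hclt : ∀ P, μ.weight P * N < c P + 1 := fun P => Nat.lt_floor_add_one _
  have hcsumR : ((∑ P ∈ μ.support, c P : ℕ) : ℝ) ≤ N := by
    push_cast
    calc ∑ P ∈ μ.support, (c P : ℝ) ≤ ∑ P ∈ μ.support, μ.weight P * N := Finset.sum_le_sum fun P _ => hcle P
      _ = N := by rw [← Finset.sum_mul, μ.sum_weight, one_mul]
  have hcsum : ∑ P ∈ μ.support, c P ≤ N := by exact_mod_cast hcsumR
  -- the list of slots
  set L : List (Fin m → MvPolynomial (Fin n) F) :=
    μ.support.toList.flatMap (fun P => List.replicate (c P) P) ++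
      List.replicate (N - ∑ P ∈ μ.support, c P) P₀ with hL
  have hlen : L.length = N := by
    rw [hL, List.length_append, List.length_flatMap, List.length_replicate]
    have : (List.map (fun P => (List.replicate (c P) P).length) μ.support.toList).sum =
        ∑ P ∈ μ.support, c P := by
      simp only [List.length_replicate]
      exact Finset.sum_map_toList _ _
    rw [this]
    omega
  have hmemL : ∀ y ∈ L, y ∈ μ.support := by
    intro y hy
    rw [hL, List.mem_append] at hy
    rcases hy with hy | hy
    · obtain ⟨P, hP, hyP⟩ := List.mem_flatMap.1 hy
      rw [(List.mem_replicate.1 hyP).2]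
      exact Finset.mem_toList.1 hP
    · rw [(List.mem_replicate.1 hy).2]; exact hP₀
  refine ⟨fun j => L.getD j P₀, fun j => ?_, fun x => ?_⟩
  · show L.getD j P₀ ∈ μ.support
    rw [List.getD_eq_getElem _ _ (by rw [hlen]; exact j.isLt)]
    exact hmemL _ (List.getElem_mem _)
  · -- count the erring indices through the list
    set g : (Fin m → MvPolynomial (Fin n) F) → ℕ := fun P => if Errs f P x then 1 else 0 with hg
    have hsumL : (L.map g).sum = ∑ P ∈ μ.support, c P * g P + (N - ∑ P ∈ μ.support, c P) * g P₀ := by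
      rw [hL, List.map_append, List.sum_append, List.map_flatMap, List.map_replicate,
        List.sum_replicate, smul_eq_mul, List.flatMap_def, List.sum_flatten, List.map_map]
      congr 1
      rw [← Finset.sum_map_toList μ.support (fun P => c P * g P)]
      congr 1
      refine List.map_congr_left fun P _ => ?_
      simp [List.map_replicate, List.sum_replicate]
    have hcount : (univ.filter fun j : Fin N => Errs f (L.getD j P₀) x).card =
        ∑ P ∈ μ.support, c P * g P + (N - ∑ P ∈ μ.support, c P) * g P₀ := by
      have hr := sum_range_getD g P₀ L
      rw [hlen, hsumL] at hr
      simp only [hg] at hr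
      rw [Finset.card_filter,
        Fin.sum_univ_eq_sum_range (fun i => if Errs f (L.getD i P₀) x then 1 else 0) N, hr]
    rw [hcount]
    push_cast
    -- first term ≤ ε N, second ≤ |support|
    have hg01 : ∀ P, (g P : ℝ) ≤ 1 := fun P => by
      simp only [hg]; split_ifs <;> simp
    have hg0 : ∀ P, (0 : ℝ) ≤ g P := fun P => Nat.cast_nonneg _
    have h1 : ∑ P ∈ μ.support, (c P : ℝ) * g P ≤ ε * N := by
      calc ∑ P ∈ μ.support, (c P : ℝ) * g P
          ≤ ∑ P ∈ μ.support, μ.weight P * N * g P :=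
            Finset.sum_le_sum fun P _ => mul_le_mul_of_nonneg_right (hcle P) (hg0 P)
        _ = N * ∑ P ∈ μ.support.filter (fun P => Errs f P x), μ.weight P := by
            rw [Finset.sum_filter, Finset.mul_sum]
            refine Finset.sum_congr rfl fun P _ => ?_
            simp only [hg]
            split_ifs <;> simp [mul_comm]
        _ ≤ N * ε := mul_le_mul_of_nonneg_left (happ x) (Nat.cast_nonneg N)
        _ = ε * N := mul_comm _ _
    have h2 : ((N - ∑ P ∈ μ.support, c P : ℕ) : ℝ) * g P₀ ≤ μ.support.card := by
      have hsub : ((N - ∑ P ∈ μ.support, c P : ℕ) : ℝ) = N - ∑ P ∈ μ.support, (c P : ℝ) := by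
        rw [Nat.cast_sub hcsum, Nat.cast_sum]
      rw [hsub]
      calc ((N : ℝ) - ∑ P ∈ μ.support, (c P : ℝ)) * g P₀
          ≤ ((N : ℝ) - ∑ P ∈ μ.support, (c P : ℝ)) * 1 := by
            refine mul_le_mul_of_nonneg_left (hg01 P₀) ?_
            rw [sub_nonneg]; exact_mod_cast hcsum
        _ ≤ ∑ P ∈ μ.support, (1 : ℝ) := by
            rw [mul_one, sub_le_iff_le_add, ← Finset.sum_add_distrib]
            calc (N : ℝ) = ∑ P ∈ μ.support, μ.weight P * N := by
                  rw [← Finset.sum_mul, μ.sum_weight, one_mul]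
              _ ≤ ∑ P ∈ μ.support, (1 + (c P : ℝ)) :=
                  Finset.sum_le_sum fun P _ => by linarith [hclt P]
        _ = μ.support.card := by simp
    linarith

/-- **Distribution form ⇒ uniform-family form** (with any slack `δ > 0` in the error): choose
`N ≥ |supp μ|/δ`. [cite: GrewalKumar2024, Thm. 3.8 (proof, averaging)] -/
theorem hasUniformProbDegree_of_hasProbDegree {f : Fin m → (Fin n → Bool) → Bool} {ε : ℝ} {d : ℕ}
    (h : HasProbDegree F f ε d) {δ : ℝ} (hδ : 0 < δ) : HasUniformProbDegree F f (ε + δ) d := by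
  obtain ⟨μ, hdeg, happ⟩ := h
  -- `N = ⌈|supp|/δ⌉ + 1`
  set N : ℕ := ⌈(μ.support.card : ℝ) / δ⌉₊ + 1 with hN
  have hNpos : 0 < N := Nat.succ_pos _
  have hsupp : (μ.support.card : ℝ) ≤ δ * N := by
    have h1 : (μ.support.card : ℝ) / δ ≤ ⌈(μ.support.card : ℝ) / δ⌉₊ := Nat.le_ceil _
    have h2 : (⌈(μ.support.card : ℝ) / δ⌉₊ : ℝ) ≤ N := by rw [hN]; push_cast; linarith
    rw [div_le_iff₀ hδ] at h1
    nlinarith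
  obtain ⟨G, hG, herr⟩ := μ.exists_uniform_family f happ N
  refine ⟨N, hNpos, G, fun j i => hdeg _ (hG j) i, fun x => (herr x).trans ?_⟩
  rw [add_mul]
  linarith

end ProbPoly

end Smolensky

end Literature.Computability.MetaComplexity
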